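import Summits.BirchSwinnertonDyer.BirchSwinnertonDyer.Theorems.RamifiedHeegnerPairLeafPartnerOrdersBrandtCoordinateRun
import Summits.BirchSwinnertonDyer.BirchSwinnertonDyer.Theorems.RamifiedHeegnerPairLeafPartnerCokernelFifthCoordinates
import Literature.NumberTheory.EllipticCurves.NonEisensteinPrimeOfSurjective
import Literature.NumberTheory.EllipticCurves.ComplexMultiplicationLFunctionIsogenyHoldsProofs
import HarnessLib

/-!
# Route `RamifiedHeegnerPair`, crux U₁ `LeafRankOneUpperAtThree` (stmt-BirchSwinnertonDyer-26022), line `partnerdescent` —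
# partner kernel, base change (α) part 9: (G3♭ᶜ) `CokernelFifthInCoordinatesAtThree` FROM THE TYPED BRANDT-COORDINATE INPUTS

HONEST FRAMING. Theorems only; helper file (`--supports stmt-BirchSwinnertonDyer-26022 --as helper`); composes ‹…BrandtCoordinateRun›
(`not_dvd_of_brandtCoordinateInputs`) with the tree's Mazur–Chebotarev prime (`exists_prime_not_dvd_lFunction_sub_of_hasIrreducibleModPGaloisRep`,
‹NonEisensteinPrimeOfSurjective›) and isogeny invariance of `a_n` (`LFunction_eq_of_isIsogenous_holds`); no new number theory, no named fact,
no `sorry`; nothing booked; BSD is proved for no curve. Lead prover bsd-line-rhp-p2 g64, 2026-08-31.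

WHAT. `cokernelFifth_of_leafBrandtInputs`: the line's stub (G3♭ᶜ) `Partnerdescent.CokernelFifthInCoordinatesAtThree` — UNFOLDED VERBATIM as
the conclusion — follows from ONE hypothesis `hIn`, the conjunction of the TYPED PRINT INPUTS in Brandt coordinates, quantified over the stub's
binders (`N = DM` admissible, `D = p·d`, `W` of conductor `N`, `3 ∤ N`, `ρ̄_{W,3}` irreducible, `W` split at `d` with `#W(ℚ_d)[3] ≠ 9`, `P`
class-minimal for `W` with curve `W′`, `S` a Brandt setup of type `(pM, d)`): there exist the degree-zero lattice `B`, commuting generators `G`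
containing the Brandt matrices at the good primes and preserving `B`, an integral Atkin–Lehner twist `W, W′` commuting with those Brandt
matrices with `Xᵀ·D_w W = D_w W·X` on `G` (C0), eigenvalues `λ_X` on the `a(W′)`-eigen-line, the character-group dictionary `Y, π^*, π_*`
(`hDictDisc` of ‹…BrandtDictionaryProofs› with `Y ≤ B` and `G`-stability) (D⁺), the new-projector (C2′), multiplicity one in cosocle form
at `(3, X − λ_X)` (C3′), and «`δ·(C y) = a·π_*(y)·π^*1` on `Y` ⟹ `δ ∣ a`» (C5′). This is what the successor skeleton (partnerdescent v9 ∕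
splitkolyvagin0 v22) calls `LeafBrandtCoordinateInputsAtThree`: the stub (G3♭ᶜ) becomes DERIVED and the new stub is PRINT (five named
sources: Ribet 1990 Thm. 4.1 ∕ Takahashi 2001 Prop. 3.1 for (D⁺); W. Zhang 2014 §3.9 ∕ Gross 1987 for (C0); Jacquet–Langlands + the Deligne
bound for (C2′); Mazur's principle — DDT 1995 Thm. 4.26 (a), Helm 2007 Lemma 6.5 — for (C3′); Papikian–Rabinoff 2016 ¶23 + Lemma 24 for (C5′)).
[cite: Takahashi2001, Prop. 3.1, Thm. 3.2 (a)] [cite: Ribet1990, Thm. 4.1, Thm. 5.2 (b)] [cite: DarmonDiamondTaylor1995, Thm. 4.26 (a)]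
[cite: Helm2007, Def. 6.4, Lemma 6.5] [cite: PapikianRabinoff2016, §3 ¶23, Lemma 24] [cite: Mazur1978, Thm. 1]
-/

set_option linter.dupNamespace false
set_option autoImplicit false

noncomputable section

open scoped Pointwise

namespace Summit.BirchSwinnertonDyer.BirchSwinnertonDyer.Theorems.LeafPartnerOrders

open Matrix
open Literature.NumberTheory.Automorphic Literature.NumberTheory.Automorphic.Brandt Literature.NumberTheory.EllipticCurves

open scoped Classical in
/-- **(G3♭ᶜ) from the typed Brandt-coordinate inputs** (see the module docstring). The conclusion is
`Partnerdescent.CokernelFifthInCoordinatesAtThree` unfolded verbatim. [cite: Takahashi2001, Thm. 2.3, Thm. 3.2 (a)]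
[cite: PapikianRabinoff2016, §3 ¶23–¶25, Lemma 24, Lemma 32] [cite: Mazur1978, Thm. 1] -/
theorem cokernelFifth_of_leafBrandtInputs
    (hIn : ∀ {N D M p d : ℕ}, p.Prime → D = p * d → IsAdmissibleFactorization N D M →
      ∀ (X : ShimuraCurveData D M) (W : WeierstrassCurve ℚ) [W.IsElliptic] [W.IsGloballyMinimal],
        W.conductorNorm ℤ = N → ¬ 3 ∣ N → W.HasIrreducibleModPGaloisRep 3 →
      ∀ [Fact d.Prime], d ≠ p → W.HasSplitMultiplicativeReductionAtPrime d →
        Nat.card (AddSubgroup.torsionBy ((W.baseChange ℚ_[d]).toAffine.Point) 3) ≠ 9 →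
      ∀ (W' : WeierstrassCurve ℚ) [W'.IsElliptic] (P : ShimuraParametrizationData X W'), P.IsMinimalFor W →
      ∀ (S : Brandt.XiSetup (p * M) d) [Fintype (ClassSet S.O)] [DecidableEq (ClassSet S.O)],
      ∃ (B : Submodule ℤ (ClassSet S.O → ℤ)) (G : Set (Matrix (ClassSet S.O) (ClassSet S.O) ℤ))
        (W₁ W₂ : Matrix (ClassSet S.O) (ClassSet S.O) ℤ) (lam : Matrix (ClassSet S.O) (ClassSet S.O) ℤ → ℤ)
        (Y : Submodule ℤ (ClassSet S.O → ℤ)) (pb : ℤ →ₗ[ℤ] Y) (pf : Y →ₗ[ℤ] ℤ)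
        (uY : Matrix (ClassSet S.O) (ClassSet S.O) ℤ) (N₀ : ℤ) (x₀ : ClassSet S.O → ℤ),
        -- the degree-zero lattice
        (∀ v, v ∈ B ↔ ∑ c, v c = 0) ∧
        -- (C0) generators and twist
        (∀ X₁ ∈ G, ∀ X₂ ∈ G, X₁ * X₂ = X₂ * X₁) ∧
        (∀ X₁ ∈ G, ∀ v : ClassSet S.O → ℤ, ∑ c, v c = 0 → ∑ c, (X₁ *ᵥ v) c = 0) ∧
        (∀ q : ℕ, q.Prime → ¬ q ∣ p * M * d → Brandt.matrix S.O q ∈ G) ∧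
        W₁ * W₂ = 1 ∧ W₂ * W₁ = 1 ∧
        (∀ v : ClassSet S.O → ℤ, ∑ c, v c = 0 → ∑ c, (W₁ *ᵥ v) c = 0) ∧
        (∀ v : ClassSet S.O → ℤ, ∑ c, v c = 0 → ∑ c, (W₂ *ᵥ v) c = 0) ∧
        (∀ q : ℕ, q.Prime → ¬ q ∣ p * M * d → W₁ * Brandt.matrix S.O q = Brandt.matrix S.O q * W₁) ∧
        (∀ X₁ ∈ G, X₁ᵀ * (Matrix.diagonal (fun c ↦ (weight S.O c : ℤ)) * W₁) =
          (Matrix.diagonal (fun c ↦ (weight S.O c : ℤ)) * W₁) * X₁) ∧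
        (∀ X₁ ∈ G, ∀ v ∈ eigenLattice (p * M * d) (Brandt.matrix S.O) (fun n ↦ W'.LFunction n), X₁ *ᵥ v = lam X₁ • v) ∧
        -- (D⁺) the character-group dictionary, with `Y ≤ B` and `G`-stability
        (∀ (a : ℤ) (y : Y), ∑ k, (weight S.O k : ℤ) * (pb a : ClassSet S.O → ℤ) k * (y : ClassSet S.O → ℤ) k =
          ((W'.minimalDiscriminantNorm ℤ).factorization p : ℤ) * a * pf y) ∧
        (∀ a : ℤ, pf (pb a) = (P.deg : ℤ) * a) ∧ Function.Surjective pf ∧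
        (∀ (k : ℤ) (v : ClassSet S.O → ℤ), k ≠ 0 → k • v ∈ Y → v ∈ Y) ∧
        Module.finrank ℤ (eigenLattice (p * M * d) (Brandt.matrix S.O) (fun n ↦ W'.LFunction n)) = 1 ∧
        (pb 1 : ClassSet S.O → ℤ) ∈ eigenLattice (p * M * d) (Brandt.matrix S.O) (fun n ↦ W'.LFunction n) ∧
        Y ≤ B ∧ (∀ X₁ ∈ G, ∀ y ∈ Y, X₁ *ᵥ y ∈ Y) ∧
        -- (C2′) the new-projector
        uY ∈ Algebra.adjoin ℤ G ∧ N₀ ≠ 0 ∧ (∀ y ∈ Y, uY *ᵥ y = N₀ • y) ∧ (∀ b ∈ B, uY *ᵥ b ∈ Y) ∧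
        -- (C3′) multiplicity one in cosocle form at `(3, X − λ_X)`
        x₀ ∈ B ∧ (∀ x ∈ B, ∃ C ∈ Algebra.adjoin ℤ G, x - C *ᵥ x₀ ∈
          (3 : ℤ) • B ⊔ ⨆ X₁ ∈ G, B.map (Matrix.mulVecLin (X₁ - lam X₁ • (1 : Matrix (ClassSet S.O) (ClassSet S.O) ℤ)))) ∧
        -- (C5′) the optimal degree divides the congruence number
        (∀ C ∈ Algebra.adjoin ℤ G, ∀ a : ℤ,
          (∀ y (hy : y ∈ Y), (P.deg : ℤ) • (C *ᵥ y) = a • pf ⟨y, hy⟩ • (pb 1 : ClassSet S.O → ℤ)) → (P.deg : ℤ) ∣ a)) :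
    ∀ {N D M p d : ℕ}, p.Prime → D = p * d → IsAdmissibleFactorization N D M →
      ∀ (X : ShimuraCurveData D M) (W : WeierstrassCurve ℚ) [W.IsElliptic] [W.IsGloballyMinimal],
        W.conductorNorm ℤ = N → ¬ 3 ∣ N → W.HasIrreducibleModPGaloisRep 3 →
      ∀ [Fact d.Prime], d ≠ p → W.HasSplitMultiplicativeReductionAtPrime d →
        Nat.card (AddSubgroup.torsionBy ((W.baseChange ℚ_[d]).toAffine.Point) 3) ≠ 9 →
      ∀ (W' : WeierstrassCurve ℚ) [W'.IsElliptic] (P : ShimuraParametrizationData X W'), P.IsMinimalFor W →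
      ∀ (S : Brandt.XiSetup (p * M) d) (i j : ℕ), 0 < i →
        i * j = (W'.minimalDiscriminantNorm ℤ).factorization p →
        P.deg * i = S.xi (fun n => W'.LFunction n) * j → ¬ 3 ∣ j := by
  intro N D M p d hp hD hadm X W _ _ hN h3 hirr _ hdp hsplit hcard W' _ P hP S i j hi hij hδi
  letI : Fintype (ClassSet S.O) := Fintype.ofFinite _
  obtain ⟨B, G, W₁, W₂, lam, Y, pb, pf, uY, N₀, x₀, hB, hGcomm, hGdeg, hGan, hWW', hW'W, hWdeg, hW'deg, hWT, hadj, hglam,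
    hadjY, hδ, hsurj, hYsat, hrank, hmem, hYB, hYG, huYG, hN₀, huY, huYB, hx₀, hmult, hC5⟩ :=
    hIn hp hD hadm X W hN h3 hirr hdp hsplit hcard W' P hP S
  -- the Mazur–Chebotarev prime `ℓ ∤ N` with `3 ∤ a_ℓ − ℓ − 1`
  obtain ⟨ℓ, hℓ, -, hℓN, h3ℓ⟩ := exists_prime_not_dvd_lFunction_sub_of_hasIrreducibleModPGaloisRep W 3 hirr
  have hLW : W'.LFunction = W.LFunction := (LFunction_eq_of_isIsogenous_holds W W' hP.1).symm
  have hℓN' : ¬ ℓ ∣ p * M * d := by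
    rw [hN] at hℓN
    have : p * M * d = N := by rw [← hadm.mul_eq, hD]; ring
    rwa [this]
  have h3ℓ' : ¬ (3 : ℤ) ∣ (fun n ↦ W'.LFunction n) ℓ - (ℓ + 1) := by
    simp only [hLW]
    exact_mod_cast h3ℓ
  exact not_dvd_of_brandtCoordinateInputs S (fun n ↦ W'.LFunction n) hℓ hℓN' h3ℓ' hrank B hB G hGcomm hGdeg hGan W₁ W₂ hWW' hW'W
    hWdeg hW'deg (hWT ℓ hℓ hℓN') hadj lam hglam Y pb pf _ P.deg P.deg_pos hadjY hδ hsurj hYsat hmem hYB hYG uY huYG N₀ hN₀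
    huY huYB x₀ hx₀ hmult hC5 i j hi hij hδi

end Summit.BirchSwinnertonDyer.BirchSwinnertonDyer.Theorems.LeafPartnerOrders

end
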